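import Summits.QuantumFields.BalabanUV.T4Continuum.Support.ShellMeasureLiveEndOneCall
import Summits.QuantumFields.BalabanUV.T4Continuum.Support.ShellMeasureLandauEndFinalToyMass
import Summits.QuantumFields.BalabanUV.T4Continuum.Support.ShellMeasureLandauEndAssembledToy

/-!
# `T4Continuum.ShellMeasureLiveEndOneCallToy` — row S96 «RULE G-1 FOR THE ONE CALL»: S92 f2
# `ShellMeasureLiveEndOneCall.shellWeightBound_live_oneCall` FIRED BY NAME, EVERY BINDER SUPPLIED, on a two-run toy scheme at TWO
# DIFFERENT fine scales (`η = 1`, `η = ½`) whose slots are leaf-04's one-plaquette `SU(2)` model (row S88) — live shells, summable weight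
(cell `pub-balaban`, sub-cell `t4`, spine estimate NE7c (node U5b); NE7c ROUND-2 crew, unit `b2b-balaban-t4-ne7c-formalise-leaf-10`
gen 12; OFFER l.19483 → owner g34 RULING R-ne7cp1-g34-2 (d): NEW ROW **S96**, GO, with the request «if the toy can carry two slots,
give them two different `η` and a nonzero read-out» — done: run A at `η = 1`, run B at `η = ½`, read-out `toyReadOut ≠ 0` (§3);
ADDITIVE — imports S92 f2 `ShellMeasureLiveEndOneCall` (p231406), leaf-04-g8's S88 f2 `ShellMeasureLandauEndFinalToyMass` (p230888)
and leaf-01-g8's S80 f4 `ShellMeasureLandauEndAssembledToy` (p230964) ONLY — S88's data `b₁ toyCentre toyF toyU toyReadOut toyJco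
toyεθ` + lemmas, S88 f2's `m₀_eq_three`∕`toy_shellMass_eq`∕`haar_shell_pos`∕`toy_totalMass_pos_le_one`, S80 f4's `norm_kerOp_zero_le`
ALL BY NAME; [folklore]; 0 `def`, 0 `def … : Prop`, 0 sorry, 0 citation tags)

HONEST FRAMING.  A TOY: a CONSISTENCY CERTIFICATE of the ≈ 370-name hypothesis list of THE ONE CALL (row S92: END-I (S27) ∘
END-II-final most-assembled (S80 f3) ∘ the γ8 unit change (S90), ONE declaration concluding LITERALLY `ShellWeightBound …`) —
nothing about Bałaban's minimiser, propagators, kernels, densities or counts.  Finite four-torus programme, rung (B)+1 only — NOT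
infinite volume, NOT a mass gap, NOT the Clay problem, NOT summit progress; NE7c (`T4IndicatorShell.ShellWeightBound` for the
cell's expansions) NOT PRINTED, NOT PROVED; «NE7c ⇐ the named binders» (c3); `ShellWeightBound` on a toy ≠ NE7c.  HONEST DEPENDENCY
(cell): continuum YM on T⁴ ⇐ BetaPertH ∧ nine spine estimates (0/9 proved); BetaPertH ⇐ (D1) ∧ (D4) ∧ CAP+tail; G-an2-4 gates
asym, D1 and NE2/3/4.

THE SCHEME (§2 **`shellWeightBound_live_oneCall_toy`**).  Slot index `σ := Unit`: ONE slot per comparison index `K` in each run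
`r : Bool`, at END-I level `lvl r K () = K` (window depth `N₁ = 0`, count `ν̄ = 1`), lattice `(P, j)` fixed; the slot of run `r` at
`K` is S88's model at a plaquette `p r K : Plaq P j` (block `{b₁ (p r K)}`, `T = ∅`, density `toyF` = `𝟙[dist1 U(∂p) ≤ 2 sin(S∕2)]`,
variable `toyU = dist1 U(∂p)`, covariant centre, ONE skew read-out `toyReadOut` = the chart's `su(2)` letter, NONZERO); every
`(r, K, t, s)`-family of S92 f1's END-II binders is met index-wise by S88's (T1)∕window∕co-test∕real-structure∕dictionary data and by
S80 f4's DEGENERATE-BUT-LEGAL (T2)∕(T3)∕(S78) data (index types `Unit`, fibres `ℂ`, zero kernels, `W𝒱 = 0`, `β ≡ 0`; re-supplied as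
families); SCALES **`η true ≡ 1`, `η false ≡ ½`** with the SHARED letter∕curl norms `κr = κc = 3` and `c₁ = 4`, `c₂ = 2`, `zs = 1`
(the rows `hs₁`∕`ha` hold at both scales, with equality at `η = ½`), thresholds `ε ≡ 4·toyεθ S` ((SM) `hsm` with equality), widths
`ρ r j := ϑ^j∕4` (`≤ ¼ = (1−δ)∕2`, rate constant `¼`), `D ≡ D̄ = 12` with `hDslot` DISCHARGED from S80 f3's displayed slot constant
(`m₀ = 3`; the `β`∕`L_K`∕`B_d` terms vanish); END-I rows: `T K = {()}`, weights = total masses of the realized laws (`hFfin`: `toyF ≤ 1`),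
pieces = realized shell masses PUSHED WITH EQUALITY (`M ≡ 1`) — run A's shell `{4θ₀(1 − ρ_K) ≤ toyU∕1² < 4θ₀}`, run B's
`{4θ₀(1 − ρ_K) ≤ toyU∕(½)² < 4θ₀}`, `θ₀ = toyεθ S`.  CONCLUSION LITERALLY `ShellWeightBound l₀ (K ↦ {()}) A B shA shB (K ↦ Σ_{s∈{()}}
12·(ϑ^K∕4) + Σ_{s∈{()}} 12·(ϑ^K∕4))` for every `l₀`, `0 < S < 1∕6`, `0 < ϑ < 1`, any plaquette families.  §3: NON-DEGENERATE — for
`0 < S ≤ 10⁻⁶` both runs' shell parts are STRICTLY POSITIVE at every `K` (one-link classes of positive Haar mass inside the window),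
weights positive, `Wsh K = 6ϑ^K`, read-out `≠ 0` (`toyReadOut_ne_zero`).  Had a family NOT been jointly inhabitable, that would have
been a FINDING; none arose.  NOT DONE: the (T2)∕(T3) estimates (zero kernels), the two-run closeness (END-I takes (M1) per run).
SCALE CAVEAT (leaf-05-g9's FINDING F-ne7cL05g9-1 l.19440 `ShellMeasureLiveEndSharedLetters` + owner F-ne7cp1-g34-1 (b) l.19650
`ShellMeasureLiveEndLevelBlind`): S92's letter∕curl norms and `K_w` are LEVEL-BLIND; this scheme lives at `inf η = ½ > 0`, where the
shared typing is inhabitable non-degenerately (as here) — at Bałaban's scales `η_j = L^{−j} → 0` it forces `κr = κc = 0`.  So this is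
the (x1) of S92 f2 «of record WITH CAVEAT» and the (x2) SHAPE (two scales, nonzero read-out) asked of row S95's level-indexed twin,
which takes the same script with `κr κc Kw` as families.  NOTHING in the countdown moves.
-/


noncomputable section

open Set Metric NormedSpace MeasureTheory Function

namespace Summit.QuantumFields.BalabanUV.T4Continuum.ShellMeasureLiveEndOneCallToy

open scoped ENNReal Matrix.Norms.L2Operator
open Literature.MathematicalPhysics.QuantumFieldTheory.Balaban1983to89
open B11Prop6Scheme (Prop4Hyp)
open GaugeField (GaugeInvariant plaqHol)
open T4ShellMeasure (SlotAntiConcentration)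
open T4CubePoincare (cube mem_cube_iff)
open T4CubeChartGnomonic (SU2)
open T4CubeChartExp (expPt expFibreChart)
open T4TreeGaugeFixing (NoClosedLoop fixTo noClosedLoop_empty fixTo_empty)
open T4ExpWindowSmallField (dist1_expPt_eq dist1_eq_norm_coe_sub_one)
open T4ShellMeasurePlaquette (expTail₂)
open T4IndicatorShell (ShellWeightBound)
open T4ShellMeasureLevels (LiveWindow)
open ShellMeasureLevelAssembly (classifier)
open ShellMeasureWilsonWords (wordExp wordExp_cons wordExp_nil)
open ShellMeasureMultiGridNorms (WSup)
open ShellMeasurePinnedNorm (pinW)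
open ShellMeasureDecayKernelSums (kerOp kerOp_apply)
open ShellMeasureLandauHolonomy (solAt landauExp)
open ShellMeasureLandauHolonomyChart (holOf cplx holOf_apply)
open ShellMeasureLandauHolonomySkew (readOutReal)
open ShellMeasureWilsonRealizedSU2 (M₂ gen coe_chart gen_mem_skewAdjoint)
open ShellMeasureLandauEndFinalToy (b₁ toyCentre toyF toyU tau toyReadOut toyJco toyεθ measurable_toyF measurable_toyU
  gaugeInvariant_toyF gaugeInvariant_toyU toyF_le_one toyF_one toyF_supp norm_tau toyReadOut_apply norm_toyReadOut_le
  toyReadOut_cplx solAt_zero landauExp_zero smul_mem_cube toyF_section_mono toyεθ_pos dist1_plaqHol_section toy_threshold_lt_window)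
open ShellMeasureLandauEndFinalToyMass (m₀_eq_three toy_shellMass_eq haar_shell_pos toy_totalMass_pos_le_one)
open ShellMeasureLandauEndAssembledToy (norm_kerOp_zero_le)
open ShellMeasureLiveEndOneCall (shellWeightBound_live_oneCall)

variable {P : Params} {j : ℕ}

/-! ## §1 Small suppliers: finiteness of the realized laws, the one-slot window -/

/-- the toy density integrates to at most `1` against product Haar (`toyF ≤ 1`, `fieldMeasure` a probability measure): END-I's
finiteness binder `hFfin`. [folklore] -/
theorem lintegral_toyF_ne_top (S : ℝ) (p : Plaq P j) : ∫⁻ U, toyF S p U ∂(fieldMeasure P j SU2) ≠ ∞ :=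
  ne_top_of_le_ne_top ENNReal.one_ne_top
    (((lintegral_mono fun U => toyF_le_one S p U).trans_eq (by rw [lintegral_one, measure_univ])))

/-- the realized law of the toy slot is finite on every event (`0 < S < 1∕6`). [folklore] -/
theorem toy_measure_ne_top {S : ℝ} (hS : 0 < S) (hS6 : S < 1 / 6) (p : Plaq P j) (B : Set (GaugeField P j SU2)) :
    ((fieldMeasure P j SU2).withDensity (toyF S p)) B ≠ ∞ :=
  ne_top_of_le_ne_top (ne_top_of_le_ne_top ENNReal.one_ne_top (toy_totalMass_pos_le_one hS hS6 p).2) (measure_mono (subset_univ B))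

/-- (W1) for ONE slot per comparison index at the top level: depth `N₁ = 0`, count `ν̄ = 1`. [folklore] -/
theorem oneSlot_liveWindow : LiveWindow (fun _ : ℕ => ({()} : Finset Unit)) (fun K _ => K) 0 1 :=
  ⟨fun _ _ _ => le_rfl, fun _ _ _ => le_rfl, fun K j' => by
    exact_mod_cast (Finset.card_filter_le ({()} : Finset Unit) (fun _ => K = j')).trans (Finset.card_singleton _).le⟩

/-! ## §2 THE ONE CALL APPLIED BY NAME TO THE TOY SCHEME -/

/-- **RULE G-1 FOR THE ONE CALL.**  For every lattice `(P, j)`, plaquette families `p : Bool → ℕ → Plaq P j` (run, comparison index),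
chart enumerations `e r K`, window `0 < S < 1∕6`, rate `0 < ϑ < 1` and source radius `l₀`: S92 f2
`ShellMeasureLiveEndOneCall.shellWeightBound_live_oneCall` APPLIED BY NAME, every one of its binder families met by the data of the
module docstring (S88's model per slot, S80 f4-type degenerate (T2)∕(T3)∕(S78) data, scales `η true ≡ 1`, `η false ≡ ½`,
`ε ≡ 4·toyεθ S`, `ρ_j = ϑ^j∕4`, `D ≡ 12`,
one slot and one term per `K`, pieces pushed with equality) — NONE left as a hypothesis — yields END-I's LITERAL `ShellWeightBound`
for the toy two-run scheme with the weight `K ↦ Σ_{s∈{()}} 12·(ϑ^K∕4) + Σ_{s∈{()}} 12·(ϑ^K∕4)`.  A consistency certificate of the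
ONE CALL's hypothesis list; nothing about Bałaban's objects; NE7c NOT PROVED. [folklore] -/
theorem shellWeightBound_live_oneCall_toy [DecidableEq (PBond P j)] (p : Bool → ℕ → Plaq P j) {m₀ : Bool → ℕ → ℕ}
    (e : ∀ r K, ↥({b₁ (p r K)} : Finset (PBond P j)) × Fin 3 ≃ Fin (m₀ r K)) {S : ℝ} (hS : 0 < S) (hS6 : S < 1 / 6)
    {ϑ : ℝ} (hϑ0 : 0 < ϑ) (hϑ1 : ϑ < 1) (l₀ : ℝ) :
    ShellWeightBound l₀ (fun _ : ℕ => ({()} : Finset Unit))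
      (fun K _ _ => (((fieldMeasure P j SU2).withDensity (toyF S (p true K))) Set.univ).toReal)
      (fun K _ _ => (((fieldMeasure P j SU2).withDensity (toyF S (p false K))) Set.univ).toReal)
      (fun K _ _ => (((fieldMeasure P j SU2).withDensity (toyF S (p true K)))
        {U | 4 * toyεθ S * (1 - ϑ ^ K / 4) ≤ toyU (p true K) U / 1 ^ 2 ∧ toyU (p true K) U / 1 ^ 2 < 4 * toyεθ S}).toReal)
      (fun K _ _ => (((fieldMeasure P j SU2).withDensity (toyF S (p false K)))
        {U | 4 * toyεθ S * (1 - ϑ ^ K / 4) ≤ toyU (p false K) U / (1 / 2) ^ 2 ∧ toyU (p false K) U / (1 / 2) ^ 2 < 4 * toyεθ S}).toReal)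
      (fun K => ∑ _s ∈ ({()} : Finset Unit), (12 : ℝ) * (ϑ ^ K / 4) + ∑ _s ∈ ({()} : Finset Unit), (12 : ℝ) * (ϑ ^ K / 4)) := by
  have hSπ : 3 * S ^ 2 < Real.pi ^ 2 := by nlinarith [Real.pi_gt_three]
  have hρ1 : ∀ K : ℕ, ϑ ^ K / 4 ≤ (1 - 1 / 2) / 2 := fun K => by
    have := pow_le_one₀ hϑ0.le hϑ1.le (n := K); linarith
  -- the per-run END-I rows (both runs have the same shape; `r` selects the plaquette family and the scale `cond r 1 ½`)
  set μ : Bool → ℕ → Measure (GaugeField P j SU2) := fun r K => (fieldMeasure P j SU2).withDensity (toyF S (p r K)) with hμ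
  set Sh : Bool → ℕ → Set (GaugeField P j SU2) := fun r K =>
    {U | 4 * toyεθ S * (1 - ϑ ^ K / 4) ≤ toyU (p r K) U / cond r 1 (1 / 2) ^ 2 ∧ toyU (p r K) U / cond r 1 (1 / 2) ^ 2 < 4 * toyεθ S}
    with hSh
  have sh_nonneg : ∀ (r : Bool) (K : ℕ) (t : ℝ), |t| ≤ l₀ → ∀ τ ∈ ({()} : Finset Unit), 0 ≤ (μ r K (Sh r K)).toReal :=
    fun _ _ _ _ _ _ => ENNReal.toReal_nonneg
  have sh_le : ∀ (r : Bool) (K : ℕ) (t : ℝ), |t| ≤ l₀ → ∀ τ ∈ ({()} : Finset Unit),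
      (μ r K (Sh r K)).toReal ≤ (μ r K Set.univ).toReal :=
    fun r K _ _ _ _ => ENNReal.toReal_mono (toy_measure_ne_top hS hS6 (p r K) _) (measure_mono (subset_univ _))
  have cover : ∀ (r : Bool) (K : ℕ) (t : ℝ), |t| ≤ l₀ → ∀ τ ∈ ({()} : Finset Unit),
      (μ r K (Sh r K)).toReal ≤ ∑ _s ∈ ({()} : Finset Unit), (μ r K (Sh r K)).toReal :=
    fun _ _ _ _ _ _ => by rw [Finset.sum_singleton]
  have hM : ∀ (r : Bool) (K : ℕ) (t : ℝ), |t| ≤ l₀ → ∀ s ∈ ({()} : Finset Unit), (0 : ℝ) ≤ 1 :=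
    fun _ _ _ _ _ _ => zero_le_one
  have piece_le : ∀ (r : Bool) (K : ℕ) (t : ℝ), |t| ≤ l₀ → ∀ s ∈ ({()} : Finset Unit),
      ∑ _τ ∈ ({()} : Finset Unit), (μ r K (Sh r K)).toReal ≤ 1 * (μ r K (Sh r K)).toReal :=
    fun _ _ _ _ _ _ => by rw [Finset.sum_singleton, one_mul]
  have total_ge : ∀ (r : Bool) (K : ℕ) (t : ℝ), |t| ≤ l₀ → ∀ s ∈ ({()} : Finset Unit),
      1 * (μ r K Set.univ).toReal ≤ ∑ _τ ∈ ({()} : Finset Unit), (μ r K Set.univ).toReal :=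
    fun _ _ _ _ _ _ => by rw [Finset.sum_singleton, one_mul]
  refine shellWeightBound_live_oneCall (σ := Unit) (n := Fin 2) (fun _ _ _ => P) (fun _ _ _ => j) (fun _ K _ => K)
    (ε := fun _ _ => 4 * toyεθ S) (η := fun r _ => cond r 1 (1 / 2)) (ρ := fun _ j' => ϑ ^ j' / 4) (β := fun _ _ => 0)
    (D := fun _ _ => 12) (fun r _ => by cases r <;> norm_num) (fun _ _ => mul_pos four_pos (toyεθ_pos hS hS6))
    (fun _ _ => by positivity) (fun _ _ => by norm_num)
    (fun _ _ => ({()} : Finset Unit)) (l₀ := l₀)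
    (𝒴 := fun r K _ => Fin (m₀ r K) → ℂ) (𝒴' := fun r K _ => Fin (m₀ r K) → ℂ) (𝒳 := fun r K _ => Fin (m₀ r K) → ℂ)
    (𝒵 := fun r K _ => Fin (m₀ r K) → ℂ) (ℬ := fun r K _ => Fin (m₀ r K) → ℂ) (Tr := fun _ _ _ => ∅)
    (fun _ _ _ => noClosedLoop_empty) (fun _ _ _ _ => 1) (fun r K _ => {b₁ (p r K)}) (m₀ := fun r K _ => m₀ r K)
    (fun r K _ => e r K) hS hSπ (fun r K _ _ => toyCentre (p r K)) (F := fun r K _ _ => toyF S (p r K))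
    (fun r K _ _ => measurable_toyF S (p r K)) (fun r K _ _ => gaugeInvariant_toyF S (p r K))
    (fun r K _ _ => toyF_supp S (p r K) 1) (u := fun r K _ _ => toyU (p r K)) (fun r K _ _ => measurable_toyU (p r K))
    (fun r K _ _ => gaugeInvariant_toyU (p r K)) (ιc := fun _ _ _ => Unit) (Pu := fun _ _ _ _ => {()})
    (fun _ _ _ _ => Finset.singleton_nonempty ()) (fun r K _ _ _ => cube (m₀ r K) S)
    (fun r K _ _ => toyJco S (p r K) (e r K)) (δ := 1 / 2)
    (fun _ _ _ _ _ => 0) (fun _ _ _ _ _ _ => 0) (B₀ := 1) (C₄ := 0) (a₃ := 2 / 3) (ε₄ := 1 / 6)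
    (fun _ _ _ _ _ f => by simp) (fun _ _ _ _ _ => ⟨fun Y _ => by simp, differentiableOn_const _⟩) one_pos le_rfl (by norm_num)
    (dL := 1) (C₁ := 1) (B₃ := 1) (ε₁ := 1 / 12) zero_le_one zero_le_one (by norm_num) le_rfl (by norm_num)
    (by norm_num) (by norm_num)
    (fun r K _ _ _ => ContinuousLinearMap.id ℂ (Fin (m₀ r K) → ℂ)) (fun _ _ _ _ _ B => by simp) (fun _ _ _ _ _ => id) (rΦ := 1 / 6)
    (fun _ _ _ _ _ => differentiableOn_id) (fun _ _ _ _ _ => rfl)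
    (fun _ _ _ _ _ z hz => by rw [mem_ball_zero_iff] at hz; simp only [id]; linarith) hS6
    (fun _ _ _ _ _ _ => 0) (C₂ := 0) (RC := 1) le_rfl (fun _ _ _ _ _ Z _ => by simp) (fun _ _ _ _ _ => differentiableOn_const _)
    (fun _ _ _ _ _ => 0) (fun _ _ _ _ _ Y => by simp) (fun _ _ _ _ _ => 0) (fun _ _ _ _ _ X => by simp) (ε₃ := 1 / 3) (by norm_num)
    (by norm_num) (by norm_num) (fun r K _ _ _ => [toyReadOut (p r K) (e r K)]) (κr := 3) (by norm_num)
    (fun r K _ _ _ _ ℓ hℓ Y => by rw [List.mem_singleton.1 hℓ]; exact norm_toyReadOut_le (p r K) (e r K) Y) (m := 1)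
    (fun _ _ _ _ _ _ => by simp) (κc := 3) (by norm_num)
    (fun r K _ _ _ _ Y => by simpa using norm_toyReadOut_le (p r K) (e r K) Y)
    -- ══ (T2): index types `Unit`, fibres `ℂ`, zero pin profile and distance, zero decay kernels ══
    (Λw := fun _ _ _ => Unit) (Λz := fun _ _ _ => Unit) (Λw' := fun _ _ _ => Unit) (Λx := fun _ _ _ => Unit)
    (Λb := fun _ _ _ => Unit) (𝔖 := fun _ _ _ => Unit)
    (𝔄w := fun _ _ _ => ℂ) (ℭ := fun _ _ _ => ℂ) (𝔄' := fun _ _ _ => ℂ) (𝔅 := fun _ _ _ => ℂ) (𝔇 := fun _ _ _ => ℂ)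
    (δw := 0) le_rfl (fun _ _ _ _ _ => 0) (fun _ _ _ _ _ _ => 0) (fun _ _ _ _ _ _ => by simp)
    (fun _ _ _ _ => id) (fun _ _ _ _ => id) (fun _ _ _ _ => id) (fun _ _ _ _ => id) (fun _ _ _ _ => id)
    (fun _ _ _ _ _ _ _ => 0) (fun _ _ _ _ _ _ _ => 0) (fun _ _ _ _ _ _ _ => 0) (fun _ _ _ _ _ _ _ => 0)
    (c𝒢 := 0) (δ𝒢 := 0) (M𝒢 := 1) (cι := 0) (δι := 0) (Mι := 1) (cH := 0) (δH := 0) (MH := 1)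
    (cH₁ := 0) (δH₁ := 0) (MH₁ := 1)
    le_rfl zero_le_one (fun _ _ _ _ _ _ _ => by simp) (fun _ _ _ _ _ => by simp)
    le_rfl zero_le_one (fun _ _ _ _ _ _ _ => by simp) (fun _ _ _ _ _ => by simp)
    le_rfl zero_le_one (fun _ _ _ _ _ _ _ => by simp) (fun _ _ _ _ _ => by simp)
    le_rfl zero_le_one (fun _ _ _ _ _ _ _ => by simp) (fun _ _ _ _ _ => by simp)
    -- the flat lists of the Wilson tuple
    (fun _ _ _ _ _ _ => 0) (B₀w := 1) (C₄w := 0) (a₃w := 2 / 3) (ε₄w := 1 / 6) (bw := 1 / 6)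
    (fun _ _ _ _ _ f => norm_kerOp_zero_le zero_le_one f) (fun _ _ _ _ _ => ⟨fun Y _ => by simp, differentiableOn_const _⟩)
    one_pos le_rfl (by norm_num) (by norm_num) (by norm_num) (by norm_num) (fun _ _ _ _ _ B => norm_kerOp_zero_le zero_le_one B)
    (fun _ _ _ _ _ _ => 0) (rΦw := 1 / 3) (fun _ _ _ _ _ => differentiableOn_const _) (fun _ _ _ _ _ => rfl)
    (fun _ _ _ _ _ z _ => by simp) (by linarith)
    (fun _ _ _ _ _ _ => 0) (C₂w := 0) (RCw := 2) le_rfl (fun _ _ _ _ _ Z _ => by simp) (fun _ _ _ _ _ => differentiableOn_const _)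
    (fun _ _ _ _ _ Y => by simpa using norm_kerOp_zero_le zero_le_one Y) (fun _ _ _ _ _ X => norm_kerOp_zero_le zero_le_one X)
    (by norm_num) (by norm_num)
    -- localities (trivial), reaches `0`, block support, the two contraction numbers
    (fun _ _ _ _ _ _ => True) (fun _ _ _ _ _ A A' c' _ => rfl) (rW := 0) (fun _ _ _ _ _ _ _ => by simp)
    (fun _ _ _ _ _ _ => True) (fun _ _ _ _ _ A A' c' _ => rfl) (rC := 0) (fun _ _ _ _ _ _ _ => by simp)
    (fun _ _ _ _ _ z i _ => rfl) (by norm_num) (by norm_num)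
    -- ONE weight plaquette with ONE zero letter
    (𝔭 := fun _ _ _ => Unit) (fun _ _ _ _ => {()}) (fun _ _ _ _ _ => [0]) (fun _ _ _ _ _ => ∅) (fun _ _ _ _ _ => 0)
    (fun _ _ _ _ _ _ ℓ _ A A' _ => by simp_all) (fun _ _ _ _ _ _ b' hb' => absurd hb' (Finset.notMem_empty _))
    (fun _ _ _ _ _ _ => le_rfl) (κwb := 1) (κcb := 1) zero_le_one zero_le_one
    (fun _ _ _ _ _ _ ℓ hℓ => by
      rw [List.mem_singleton.1 hℓ]; exact ContinuousLinearMap.opNorm_le_bound _ zero_le_one fun Y => by simp)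
    (fun _ _ _ _ _ _ => by
      rw [List.sum_cons, List.sum_nil, add_zero]
      exact ContinuousLinearMap.opNorm_le_bound _ zero_le_one fun Y => by simp)
    (mw := 1) (fun _ _ _ _ _ _ => by simp)
    -- the Wilson tuple's real structure: everything
    (fun _ _ _ _ => ⊤) (fun _ _ _ _ => by simp) (fun _ _ _ _ => ⊤) (fun _ _ _ _ => ⊤) (fun _ _ _ _ => ⊤) (fun _ _ _ _ => by simp)
    (fun _ _ _ _ => ⊤)
    (fun _ _ _ _ _ f _ => AddSubgroup.mem_top _) (fun _ _ _ _ _ Y _ => AddSubgroup.mem_top _)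
    (fun _ _ _ _ _ Y _ => AddSubgroup.mem_top _) (fun _ _ _ _ _ X _ => AddSubgroup.mem_top _)
    (fun _ _ _ _ _ Z _ => AddSubgroup.mem_top _) (fun _ _ _ _ _ B _ => AddSubgroup.mem_top _)
    (fun _ _ _ _ _ y _ => AddSubgroup.mem_top _)
    (fun _ _ _ _ _ _ ℓ hℓ Y _ => by rw [List.mem_singleton.1 hℓ]; simp)
    -- frozen plaquettes `1`, `d = d̄ = 0`, located count `K_w = 1`
    (fun _ _ _ _ _ _ => 1) (d := fun _ _ _ _ _ => 0) (dbar := 0) (fun _ _ _ _ _ _ _ => (unitary _).one_mem)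
    (fun _ _ _ _ _ _ _ => by simp) (fun _ _ _ _ _ _ => le_rfl) le_rfl (Kw := 1) (fun _ _ _ _ => by simp)
    -- ══ (T3): the located terms' pinned tuple on `Unit → ℂ`, all operators zero, ONE zero term ══
    (Λe := fun _ _ _ => Unit) (𝔄 := fun _ _ _ => ℂ) (δ' := 0) (ϖ := fun _ _ _ _ _ => 0) le_rfl (fun _ _ _ _ _ => le_rfl)
    (𝒴e' := fun _ _ _ => ℂ) (𝒳e := fun _ _ _ => ℂ) (𝒵e := fun _ _ _ => ℂ) (ℬe := fun _ _ _ => ℂ)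
    (fun _ _ _ _ _ => 0) (fun _ _ _ _ _ _ => 0) (B₀e := 1) (C₄e := 0) (a₃e := 2 / 3) (be := 1 / 6) (ε₄e := 1 / 6)
    (fun _ _ _ _ _ f => by simp) (fun _ _ _ _ _ => ⟨fun Y _ => by simp, differentiableOn_const _⟩) one_pos le_rfl (by norm_num)
    (by norm_num) (by norm_num) (by norm_num) (by norm_num)
    (fun _ _ _ _ _ => 0) (fun _ _ _ _ _ B => by simp) (fun _ _ _ _ _ _ => 0) (rΦe := 1 / 3)
    (fun _ _ _ _ _ => differentiableOn_const _) (fun _ _ _ _ _ => rfl) (fun _ _ _ _ _ z _ => by simp) (by linarith)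
    (fun _ _ _ _ _ _ => 0) (C₂e := 0) (RCe := 1) le_rfl (fun _ _ _ _ _ Z _ => by simp) (fun _ _ _ _ _ => differentiableOn_const _)
    (fun _ _ _ _ _ => 0) (fun _ _ _ _ _ Y => by simp) (fun _ _ _ _ _ => 0) (fun _ _ _ _ _ X => by simp) (by norm_num) (by norm_num)
    (𝔱 := fun _ _ _ => Unit) (fun _ _ _ _ => {()}) (Ef := fun _ _ _ _ _ _ => 0) (rE := 1) (ee := fun _ _ _ _ _ => 0) one_pos
    (fun _ _ _ _ _ _ => differentiableOn_const _) (fun _ _ _ _ _ _ Z _ => by simp) (fun _ _ _ _ _ _ => le_rfl)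
    (fun _ _ _ _ _ => ∅) (fun _ _ _ _ _ _ A₁ A₂ _ => rfl) (fun _ _ _ _ _ => 0)
    (fun _ _ _ _ _ _ b' hb' => absurd hb' (Finset.notMem_empty _))
    (LK := 0) le_rfl (fun _ _ _ _ => by simp) (by norm_num) (BE₁ := 0) (fun _ _ _ _ _ y _ => by simp)
    -- ══ (S78): the one-point probability space, `g = 1`, `A = 0`, `B_d = 0` ══
    (Ω := fun _ _ _ => Unit) (fun _ _ _ _ => Measure.dirac ()) (g := fun _ _ _ _ _ => 1) (fun _ _ _ _ _ => zero_le_one)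
    (fun _ _ _ _ _ _ _ => 0) (Bd := 0) le_rfl
    (fun _ _ _ _ _ x _ c' _ _ => by simp) (fun _ _ _ _ _ x _ c' _ _ => by simp) (fun _ _ _ _ _ x _ c' _ _ ω => by simp) (BE₂ := 0)
    (fun _ _ _ _ _ y _ => by simp)
    -- the (T1) real structure and the dictionary (S88 VERBATIM per slot), co-tests, numbers
    (fun r K _ _ => {toyReadOut (p r K) (e r K)}) (fun _ _ _ _ => ⊤) (fun _ _ _ _ => ⊤) (fun _ _ _ _ => ⊤) (fun _ _ _ _ => by simp)
    (fun r K _ _ => readOutReal {toyReadOut (p r K) (e r K)})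
    (fun _ _ _ _ _ f _ => by simp) (fun _ _ _ _ _ Y _ => AddSubgroup.mem_top _)
    (fun _ _ _ _ _ Y _ => AddSubgroup.mem_top _) (fun _ _ _ _ _ X _ => by simp)
    (fun _ _ _ _ _ Z _ => AddSubgroup.mem_top _) (fun _ _ _ _ _ B hB => by simpa using hB)
    (fun r K _ _ _ y _ => ?_) (fun r K _ _ V x hx => ?_) (fun r K _ _ V x _ => ?_)
    (fun r K _ _ V x hJ => ?_) (fun r K _ _ V x a ha => ?_) (fun r K _ _ V x => ?_)
    (fun _ _ _ _ _ => ShellMeasureLandauHolonomyPrint.chartCube_subset_closedBall hS.le)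
    (by norm_num) (by norm_num) (c₁ := 4) (c₂ := 2) (zs := 1)
    (fun r _ _ => by cases r <;> norm_num) (fun r _ _ => by cases r <;> norm_num) (by norm_num) (fun _ _ _ => ?_)
    (fun _ j' => hρ1 j') (fun _ _ => le_rfl)
    -- the slot → level majorant: S80 f3's slot constant on the toy is `12`
    (fun r K _ _ _ _ => by rw [m₀_eq_three (p r K) (e r K)]; norm_num)
    -- END-I's own rows: one term per `K`, total masses as weights, pieces pushed with equality, `M ≡ 1`
    (ι := Unit) (T := fun _ => ({()} : Finset Unit))
    (pieceA := fun K _ _ _ => (μ true K (Sh true K)).toReal) (pieceB := fun K _ _ _ => (μ false K (Sh false K)).toReal)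
    (MA := fun _ _ _ => 1) (MB := fun _ _ _ => 1) (N₁ := 0) (νbar := 1) (Dbar := 12) (crate := 1 / 4) (ϑ := ϑ)
    (fun r K _ _ => lintegral_toyF_ne_top S (p r K))
    (sh_nonneg true) (sh_le true) (cover true) (hM true) (piece_le true) (total_ge true)
    (sh_nonneg false) (sh_le false) (cover false) (hM false) (piece_le false) (total_ge false)
    (fun _ => oneSlot_liveWindow) hϑ0 hϑ1 (fun _ _ => le_rfl) (fun _ j' => le_of_eq (by ring))
  · -- `hΦr`: the read-out of a real chart point is skew (S88's dictionary)
    intro ℓ hℓ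
    rw [Set.mem_singleton_iff.1 hℓ]
    show toyReadOut (p r K) (e r K) (cplx y) ∈ skewAdjoint M₂
    rw [toyReadOut_cplx]; exact gen_mem_skewAdjoint _ _ _ _
  · -- `hRdict`: `F(section x) = Jco V x · e^{−(0 + (0 + 0))}` on the cube — the three DEFINED profiles vanish on the toy data
    rw [fixTo_empty, toyJco, indicator_of_mem hx]
    simp
  · -- `hudict` (S88's dictionary VERBATIM)
    have h1 : expFibreChart {b₁ (p r K)} (1 : GaugeField P j SU2) (e r K) x ⟨b₁ (p r K), Finset.mem_singleton_self _⟩ =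
        expPt (fun i => x (e r K (⟨b₁ (p r K), Finset.mem_singleton_self _⟩, i))) :=
      show (1 : SU2) * _ = _ from one_mul _
    rw [fixTo_empty, toyU, dist1_plaqHol_section, dist1_eq_norm_coe_sub_one, ← h1, coe_chart]
    simp only [classifier, Finset.sup'_singleton, holOf_apply, List.map_cons, List.map_nil, wordExp_cons, wordExp_nil,
      mul_one, landauExp_zero, solAt_zero _ (by norm_num : (0 : ℝ) ≤ 1 / 6), zero_add, ContinuousLinearMap.coe_id',
      id, toyReadOut_cplx]
  · -- `hJW`
    by_contra h
    exact hJ (indicator_of_notMem h _)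
  · -- `hJ`
    unfold toyJco
    by_cases hx : x ∈ cube (m₀ r K) S
    · rw [indicator_of_mem hx, indicator_of_mem (smul_mem_cube hx ha)]
      exact toyF_section_mono hSπ (p r K) (e r K) V hx ha
    · rw [indicator_of_notMem hx]; exact bot_le
  · -- `hJ1`
    unfold toyJco
    by_cases hx : x ∈ cube (m₀ r K) S
    · rw [indicator_of_mem hx]; exact toyF_le_one S (p r K) _
    · rw [indicator_of_notMem hx]; exact bot_le
  · -- `hsm`: (SM) with equality at the threshold `4·toyεθ S` (`c₁ = 4`, `c₂ = 2`, `zs = 1`, `m = 1`)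
    unfold toyεθ
    rw [show (36 : ℝ) * (4 * 1 + ((1 : ℕ) : ℝ) ^ 2 * 2 ^ 2 * 1 ^ 2) = 288 by norm_num,
      show (1 / 2 : ℝ) * (4 * (144 / ((1 / 6) / S - 1) ^ 2)) = 288 / ((1 / 6) / S - 1) ^ 2 by ring]

/-! ## §3 The instance is NON-DEGENERATE: live shells in both runs (two scales), positive weights -/

/-- numerics: `4·toyεθ S ≤ 2 sin(S∕2)` for `0 < S ≤ 10⁻⁶` (`toyεθ S ≤ 20736 S²`, Jordan `sin(S∕2) ≥ S∕4`) — run A's raw threshold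
`4·toyεθ S·1²` sits inside S88's window. [folklore] -/
theorem four_toyεθ_le_window {S : ℝ} (hS : 0 < S) (hS6 : S ≤ 1 / 10 ^ 6) : 4 * toyεθ S ≤ 2 * Real.sin (S / 2) := by
  have hj : S / 4 ≤ Real.sin (S / 2) := by
    have h := Real.mul_le_sin (by linarith : 0 ≤ S / 2) (by linarith [Real.pi_gt_three] : S / 2 ≤ Real.pi / 2)
    have : S / 4 ≤ 2 / Real.pi * (S / 2) := by
      rw [div_mul_eq_mul_div, le_div_iff₀ Real.pi_pos]; nlinarith [Real.pi_le_four]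
    linarith
  have hR : 1 / (12 * S) ≤ 1 / (6 * S) - 1 := by
    rw [div_sub_one (by positivity), div_le_div_iff₀ (by positivity) (by positivity)]; nlinarith
  have h1 : toyεθ S ≤ 144 / (1 / (12 * S)) ^ 2 := by
    rw [toyεθ, show (1 / 6 : ℝ) / S = 1 / (6 * S) by rw [div_div]]
    exact div_le_div_of_nonneg_left (by norm_num) (by positivity) (pow_le_pow_left₀ (by positivity) hR 2)
  have h2 : (144 : ℝ) / (1 / (12 * S)) ^ 2 = 20736 * S ^ 2 := by field_simp; ring
  have h3 : 20736 * S ^ 2 ≤ 20736 * (S * (1 / 10 ^ 6)) := by nlinarith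
  nlinarith

/-- **RUN A's SHELL PART IS STRICTLY POSITIVE** (scale `η = 1`; `0 < S ≤ 10⁻⁶`, `0 < ϑ < 1`, any comparison index): the realized
mass of `{4·toyεθ S·(1 − ϑ^K∕4) ≤ toyU∕1² < 4·toyεθ S}` is a one-link class of positive Haar mass inside the window (S88 f2
`toy_shellMass_eq` + `haar_shell_pos` BY NAME). [folklore] -/
theorem shellPart_pos_A (p : Bool → ℕ → Plaq P j) {S : ℝ} (hS : 0 < S) (hS6 : S ≤ 1 / 10 ^ 6) {ϑ : ℝ} (hϑ0 : 0 < ϑ) (hϑ1 : ϑ < 1)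
    (K : ℕ) :
    0 < (((fieldMeasure P j SU2).withDensity (toyF S (p true K)))
      {U | 4 * toyεθ S * (1 - ϑ ^ K / 4) ≤ toyU (p true K) U / 1 ^ 2 ∧ toyU (p true K) U / 1 ^ 2 < 4 * toyεθ S}).toReal := by
  have hθ := four_toyεθ_le_window hS hS6
  have hθ0 : 0 < 4 * toyεθ S := mul_pos four_pos (toyεθ_pos hS (by linarith))
  have hρ : 0 < ϑ ^ K / 4 := by positivity
  have hρ1 : ϑ ^ K / 4 ≤ 1 := by have := pow_le_one₀ hϑ0.le hϑ1.le (n := K); linarith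
  have hsin : 2 * Real.sin (S / 2) ≤ 2 := by linarith [Real.sin_le_one (S / 2)]
  have hset : {U : GaugeField P j SU2 | 4 * toyεθ S * (1 - ϑ ^ K / 4) ≤ toyU (p true K) U / 1 ^ 2 ∧
        toyU (p true K) U / 1 ^ 2 < 4 * toyεθ S}
      = {U | 4 * toyεθ S * (1 - ϑ ^ K / 4) ≤ toyU (p true K) U ∧ toyU (p true K) U < 4 * toyεθ S} := by
    ext U; simp only [one_pow, div_one, mem_setOf_eq]
  rw [hset, toy_shellMass_eq (p true K) hθ]
  exact ENNReal.toReal_pos (haar_shell_pos (by nlinarith) (by nlinarith) (by nlinarith)).ne' (measure_ne_top _ _)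

/-- **RUN B's SHELL PART IS STRICTLY POSITIVE** (scale `η = ½`: the threshold `4·toyεθ S` in units is `toyεθ S` raw; `0 < S ≤ 10⁻⁵`).
[folklore] -/
theorem shellPart_pos_B (p : Bool → ℕ → Plaq P j) {S : ℝ} (hS : 0 < S) (hS5 : S ≤ 1 / 100000) {ϑ : ℝ} (hϑ0 : 0 < ϑ)
    (hϑ1 : ϑ < 1) (K : ℕ) :
    0 < (((fieldMeasure P j SU2).withDensity (toyF S (p false K)))
      {U | 4 * toyεθ S * (1 - ϑ ^ K / 4) ≤ toyU (p false K) U / (1 / 2) ^ 2 ∧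
        toyU (p false K) U / (1 / 2) ^ 2 < 4 * toyεθ S}).toReal := by
  have hθ : toyεθ S ≤ 2 * Real.sin (S / 2) := by simpa using (toy_threshold_lt_window hS hS5).le
  have hθ0 : 0 < toyεθ S := toyεθ_pos hS (by linarith)
  have hρ : 0 < ϑ ^ K / 4 := by positivity
  have hρ1 : ϑ ^ K / 4 ≤ 1 := by have := pow_le_one₀ hϑ0.le hϑ1.le (n := K); linarith
  have hsin : 2 * Real.sin (S / 2) ≤ 2 := by linarith [Real.sin_le_one (S / 2)]
  have hset : {U : GaugeField P j SU2 | 4 * toyεθ S * (1 - ϑ ^ K / 4) ≤ toyU (p false K) U / (1 / 2) ^ 2 ∧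
        toyU (p false K) U / (1 / 2) ^ 2 < 4 * toyεθ S}
      = {U | toyεθ S * (1 - ϑ ^ K / 4) ≤ toyU (p false K) U ∧ toyU (p false K) U < toyεθ S} := by
    ext U
    simp only [mem_setOf_eq]
    rw [show ((1 : ℝ) / 2) ^ 2 = 1 / 4 by norm_num, le_div_iff₀ (by norm_num : (0 : ℝ) < 1 / 4),
      div_lt_iff₀ (by norm_num : (0 : ℝ) < 1 / 4)]
    constructor <;> rintro ⟨h1, h2⟩ <;> exact ⟨by linarith, by linarith⟩
  rw [hset, toy_shellMass_eq (p false K) hθ]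
  exact ENNReal.toReal_pos (haar_shell_pos (by nlinarith) (by nlinarith) (by nlinarith)).ne' (measure_ne_top _ _)

/-- the classifier read-out of the scheme is NONZERO at every slot (its value at the first chart coordinate vector is the `su(2)`
letter `τ₀` of norm `1`) — the (x2) SHAPE «two scales, nonzero read-out» of row S95. [folklore] -/
theorem toyReadOut_ne_zero (p : Plaq P j) {m₀ : ℕ} (e : ↥({b₁ p} : Finset (PBond P j)) × Fin 3 ≃ Fin m₀) : toyReadOut p e ≠ 0 := by
  intro h
  have h1 : toyReadOut p e (fun i => if i = e (⟨b₁ p, Finset.mem_singleton_self _⟩, 0) then 1 else 0) = tau 0 := by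
    rw [toyReadOut_apply, Fin.sum_univ_three]
    simp [e.injective.eq_iff]
  have h2 := congrArg (‖·‖) h1
  simp [h, norm_tau] at h2

/-- **THE LIVE TWO-SCALE INSTANCE, PACKAGED** (`0 < S ≤ 10⁻⁶`, `0 < ϑ < 1`): THE ONE CALL's conclusion holds for the toy scheme (§2)
AND both runs' shell parts (run A at scale `η = 1`, run B at scale `η = ½`) are strictly positive at every `K` AND the classifier read-out
is NONZERO — a genuine (non-vacuous) by-name instance of the declaration of record with TWO DIFFERENT fine scales (the (x2) SHAPE asked
of row S95); the weight is `Wsh K = Σ_{s∈{()}} 12·ϑ^K∕4 + Σ_{s∈{()}} 12·ϑ^K∕4 = 6ϑ^K`.  Nothing about Bałaban's objects; NE7c NOT PROVED.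
[folklore] -/
theorem shellWeightBound_live_oneCall_toy_live [DecidableEq (PBond P j)] (p : Bool → ℕ → Plaq P j) {m₀ : Bool → ℕ → ℕ}
    (e : ∀ r K, ↥({b₁ (p r K)} : Finset (PBond P j)) × Fin 3 ≃ Fin (m₀ r K)) {S : ℝ} (hS : 0 < S) (hS6 : S ≤ 1 / 10 ^ 6)
    {ϑ : ℝ} (hϑ0 : 0 < ϑ) (hϑ1 : ϑ < 1) (l₀ : ℝ) :
    ShellWeightBound l₀ (fun _ : ℕ => ({()} : Finset Unit))
      (fun K _ _ => (((fieldMeasure P j SU2).withDensity (toyF S (p true K))) Set.univ).toReal)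
      (fun K _ _ => (((fieldMeasure P j SU2).withDensity (toyF S (p false K))) Set.univ).toReal)
      (fun K _ _ => (((fieldMeasure P j SU2).withDensity (toyF S (p true K)))
        {U | 4 * toyεθ S * (1 - ϑ ^ K / 4) ≤ toyU (p true K) U / 1 ^ 2 ∧ toyU (p true K) U / 1 ^ 2 < 4 * toyεθ S}).toReal)
      (fun K _ _ => (((fieldMeasure P j SU2).withDensity (toyF S (p false K)))
        {U | 4 * toyεθ S * (1 - ϑ ^ K / 4) ≤ toyU (p false K) U / (1 / 2) ^ 2 ∧
          toyU (p false K) U / (1 / 2) ^ 2 < 4 * toyεθ S}).toReal)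
      (fun K => ∑ _s ∈ ({()} : Finset Unit), (12 : ℝ) * (ϑ ^ K / 4) + ∑ _s ∈ ({()} : Finset Unit), (12 : ℝ) * (ϑ ^ K / 4)) ∧
    (∀ K : ℕ, 0 < (((fieldMeasure P j SU2).withDensity (toyF S (p true K)))
      {U | 4 * toyεθ S * (1 - ϑ ^ K / 4) ≤ toyU (p true K) U / 1 ^ 2 ∧ toyU (p true K) U / 1 ^ 2 < 4 * toyεθ S}).toReal) ∧
    (∀ K : ℕ, 0 < (((fieldMeasure P j SU2).withDensity (toyF S (p false K)))
      {U | 4 * toyεθ S * (1 - ϑ ^ K / 4) ≤ toyU (p false K) U / (1 / 2) ^ 2 ∧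
        toyU (p false K) U / (1 / 2) ^ 2 < 4 * toyεθ S}).toReal) ∧
    (∀ (r : Bool) (K : ℕ), toyReadOut (p r K) (e r K) ≠ 0) :=
  ⟨shellWeightBound_live_oneCall_toy p e hS (by linarith) hϑ0 hϑ1 l₀, shellPart_pos_A p hS hS6 hϑ0 hϑ1,
    shellPart_pos_B p hS (by linarith) hϑ0 hϑ1, fun r K => toyReadOut_ne_zero (p r K) (e r K)⟩

end Summit.QuantumFields.BalabanUV.T4Continuum.ShellMeasureLiveEndOneCallToy

end
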